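import Summits.BirchSwinnertonDyer.BirchSwinnertonDyer.Theses.ResidualThetaTransportAtTwo

/-! # Disproof of `ResidualSignedLambdaLowerCMAtTwo` (stmt-BirchSwinnertonDyer-22608) — findings

cdisprove work file (seat `refuter-cdisprove-stmt-BirchSwinnertonDyer-22608-g0-0`, route
`ResidualThetaTransportAtTwo`, 2026-08-28).  BSD is neither proved nor disproved by anything in this file.

## Verdict of this cycle: NO KILL — and the one named local killing mechanism is numerically DEAD

`ResidualSignedLambdaLowerCMAtTwo` (RSL_g) is the λ-part, residual form of the Kobayashi-plus
(sign `1`, even layers `m`) signed main conjecture at `p = 2` for the CM θ-partner `g`, with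
`𝒪_λ = padicCoeffIntegers (range ι)` coefficients and `S₀`-imprimitivity:
`#(𝒪/ϖ)^(d + Σ_{v∈S₀} loc_v) ≤ #Sel⁺_{S₀}(ℚ_∞, A_g)[ϖ]`, `d = λ(Lm)` (the `IsPollackPairK` branch that is
congruent to `θ_n` at EVEN `n`, i.e. Kurihara–Otsuki's `f`, `f(0) = L(g,1)/Ω`).

### 1. Why no unconditional `¬ RSL_g` is attempted
The statement has 41 binders, 15 of them data of interface type (`CuspForm`, `IsCMForm`, `IsPollackPairK`,
`FramedGaloisRep`, the comparison `Θ`, …) for which the tree has no inhabitant at `p = 2`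
(vet memo VET-RSLG-g0 §2, sha16 0cc2c63005e87feb; its BC7 probe is CLEAN and its ¬S battery 4/4 fails).
A `¬` needs a global witness; none of the cheap shapes (S₀ = ∅ is excluded by `hbad`, `n = 0` has no `Θ`,
`encard = ⊤` makes the inequality true) bites.  Not re-run here.

### 2. The decisive local mechanism (VET-RSLG-g0 §6) — computed, kit jobs j314020 (n ≤ 9) / local run (n ≤ 6)
Why-might-fail of the route: at `p = 2` the signed Coleman map `Col⁺ : H¹_Iw(ℚ_{2,∞}, T) → Λ` built from
Kobayashi's pairing with the special points might have a cokernel with `λ > 0`; then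
`λ(X⁺) = λ(Lm) − λ(coker)` and RSL_g is FALSE at `μ = 0`.  Nothing in print decides this
(Kobayashi 2003 §8 and Kitajima–Otsuki 2018 take `p` odd; Sprung 2012 §6 states `p = 2` only `⊗ ℚ`;
Kurihara–Otsuki 2006 treat `a₂ = ±2` and say `a₂ = 0` goes "by the same method as `p > 2`").

Reduction (all local at 2, curve-independent).  By Honda (Kobayashi Thm 8.4; the type identity
`2·f + f((1+X)^4−1) = 2X` holds verbatim at `p = 2`) every `E/ℚ₂` with good supersingular reduction and
`a₂ = 0` — in particular every `W` of the habitat (`GoodSS W 2`, `W.frobeniusTrace 2 = 0`) — has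
`Ê ≅ F_ss`, `log F_ss = Σ_k (−1)^k ((1+X)^{4^k} − 1)/2^k`; the lattice `L_n := log Ê(𝔪_{K_n}) ⊂ K_n`
(`K_n = ℚ₂(ζ_{2^{n+2}})⁺`, the κ-layer completed at 2) does not depend on the curve, and the 𝒪-coefficients
of `g` enter only through `⊗ 𝒪` (λ unchanged).  The tree's `signedLocalPoints κ K_v W 1 m` become
`E^± _n = L_n ∩ V^±`, `V⁺ = W₀ ⊕ ⊕_{j even ≥ 2} W_j`, `V⁻ = W₀ ⊕ ⊕_{j odd} W_j` (`W_j` = exact-level-`j`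
isotypic part).  Special points (Kobayashi Def 8.8 / Sprung Thm 2.2, valid at `p = 2`):
`c_m = ε [+] (ζ_{2^{m+2}} − 1)`, `log ε = 2/3`; their Δ-traces `d_m := Tr_{ℚ₂(ζ)/K_m} c_m ∈ E^{(−1)^m}(K_m)`
have `log d_m = 4/3 − Σ_{k ≤ (m+1)/2} (−1)^k π_{m−2k}/2^k` (`π_j = 2 − (ζ_{2^{j+2}} + ζ_{2^{j+2}}⁻¹)`,
`π₀ = 2`, `π₋₁ = 4`), `Tr_{n/n−1} d_n = −d_{n−2}` (`n ≥ 2`) and `Tr_{1/0} d₁ = −4·d₀` (at odd `p` this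
coefficient is the unit `p − 1`; at `2` one factor `2 = |Δ|`, one from `c₋₁ = [2]·generator`).
The Coleman functional `P_{d,n} : H¹(K_n,T) → Λ_n` (Kobayashi (8.23)/8.25 with `d` for `c`) has image
`≅ Hom(E^ε_n, ℤ₂)`, and by local duality `[expected image : image] = [E^ε_n : Λ_n·d^ε]`; the resolvents of
`log d_n` are `± 2^k·τ(χ)` exactly as in Kobayashi Prop 8.26, so the Mazur–Tate normalisation introduces
no character-dependent unit and `coker(Col^ε) = lim_n (E^ε_n / Λ_n d^ε)^∨`.

COMPUTED (exact ℤ₂-lattice arithmetic modulo `2^48` in `ℤ[ψ_n]`, ψ-power basis, HNF/SNF with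
valuation pivoting; script `coljob/main.py`, job j314020; `n ≤ 6` reproduced locally in 7 s):

| n | [K_n:ℚ₂] | dim V⁺ | E⁺/Λd⁺ | gens E⁺ | dim V⁻ | E⁻/Λd⁻ | E⁻/(Λd⁻ + ℤ₂d₀) | gens E⁻ | L_n/(Λd_n + Λd_{n−1}) |
|---|---|---|---|---|---|---|---|---|---|
| 0 | 1  | 1  | 0 | 1 | 1  | 0   | 0 | 1 | 0 |
| 1 | 2  | 1  | 0 | 1 | 2  | ℤ/4 | 0 | 2 | 0 |
| 2 | 4  | 3  | 0 | 1 | 2  | ℤ/4 | 0 | 2 | 0 |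
| 3 | 8  | 3  | 0 | 1 | 6  | ℤ/4 | 0 | 2 | 0 |
| 4 | 16 | 11 | 0 | 1 | 6  | ℤ/4 | 0 | 2 | 0 |
| 5 | 32 | 11 | 0 | 1 | 22 | ℤ/4 | 0 | 2 | 0 |
| 6 | 64 | 43 | 0 | 1 | 22 | ℤ/4 | 0 | 2 | 0 |
| 7 | 128 | 43 | 0 | 1 | 86 | ℤ/4 | 0 | 2 | 0 |
| 8 | 256 | 171 | 0 | 1 | 86 | ℤ/4 | 0 | 2 | 0 |

(`0` = trivial quotient; `rank Λd^± = dim V^±` in every row; all membership / trace-condition /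
trace-relation checks pass; Honda cross-check: `L_n` computed from the actual minimal models of 19a1, 27a1,
121b1, 361a1, 1849a1, 4489a1, 26569a1 coincides with `L_n(F_ss)` for every `(curve, n)` tested — see the
evidence file `TABLE-colim2.md` on the item for the per-curve grid and for level 9 (degree 512), which lands in
the job outputs `~/compute/j314020/outputs/results.md`.)

READING.  `E⁺(K_n) = Λ_n d⁺` on the nose and `E⁻(K_n) = Λ_n d⁻ + ℤ₂ d₀` with quotient `ℤ/4` concentrated
at the trivial character and at the bottom layer: the `p = 2` analogue of Kobayashi Prop 8.12 / Sprung
Thm 2.2 holds for the Δ-fixed tower, `coker(Col⁺) = 0`, `coker(Col⁻) ≅ ℤ/4` (finite), so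
`λ(coker Col^±) = μ(coker Col^±) = 0` for BOTH signs.  For RSL_g (sign `+1` ↔ `Lm`): the local level
contributes NO correction to `λ(X⁺) = λ(Lm)`; the one named killing mechanism does not bite.  What remains
between RSL_g and a theorem is GLOBAL (Kato's divisibility `⊗ℚ` for the CM form `g` at `p = 2`, absence of
finite Λ-submodules / control at `2`, the `S₀`-imprimitive local factors `loc_v`) — not decidable by
computation here, and none of it is a refuter's `¬`.

### 3. Load-bearing analysis of the hypotheses (paper; no `_false_without_` theorem is provable here,
every variant needs the same non-constructible global witness)
* `hS₀ : 2 ∉ S₀`, `hbad`, `hMS` — bookkeeping of the imprimitive Selmer set; dropping `hMS` changes the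
  meaning of `Σ loc_v` (level primes counted with the `‖a_ℓ − 1‖ < 1` branch); not a falsity source by itself.
* `IsPollackPairK … Lp Lm` + the two `d`-hypotheses (`d` = λ(Lm) as first unit coefficient): load-bearing
  for the MEANING of `d`; with `Lm` replaced by `Lp` (odd layers, Kurihara–Otsuki's `g`, divisible by
  `T + 2` by the root-number zero at the order-2 character) the count would be off by the forced zero —
  that is the minus/odd side, NOT this item.
* `¬ W.HasCM`, `W.analyticRank = 0`, `W.Δ < 0`, the residual congruence `‖a_ℓ(g) − a_ℓ(W)‖ < 1`: NOT used by
  the truth of the inequality (which is a statement about `g` alone plus the identification `Θ` of the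
  residual local condition); they pin the habitat.  Mutation finding for the prover: possibly unnecessary
  for RSL_g itself (they matter upstream in `ResidualThetaTransportAtTwo_of`).
* `Θ`-equivariance `hΘ` and `hρ` (Frobenius charpolys of `ρ_g`): load-bearing — without `hρ` the module
  `Cofree ρ` is unrelated to `g` and the left side (`d` from `Lm` of `g`) cannot bound anything.
* `Irreducible ϖ`: with `ϖ` a unit the left side is `1 ≤ #Sel[ϖ]`-trivial; with `ϖ = 0` excluded by
  irreducibility.  Fine as stated.
* `encard`: if `Sel⁺[ϖ]` is infinite (`μ(X⁺) > 0` or positive 𝒪/ϖ-corank) the inequality is TRUE for free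
  (`natCast_le_encard_of_infinite` below) — so a refutation can only come from a FINITE `Sel⁺[ϖ]` that is
  too small, i.e. from a λ-defect; §2 shows the local λ-defect is `0`.

### 4. Natural strengthenings (recorded, not claimed)
* Equality `#(𝒪/ϖ)^(d+Σ) = #Sel⁺[ϖ]` is NOT suggested by §2 for the minus sign: `coker(Col⁻) ≅ ℤ/4`
  shifts the minus-side characteristic ideal by a finite-index (μ-type at the trivial character) factor —
  harmless for λ, visible in exact cardinalities at layer 0.  For the plus sign no local obstruction to
  equality was found.
* "min # generators": `E⁻(K_n)` (hence its dual `M⁻`) needs 2 generators over `Λ_n` for every `n ≥ 1`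
  (`M⁻` is pseudo-isomorphic, not isomorphic, to `Λ`); `M⁺ ≅ Λ` on the nose.

### 5. Targets
None yet (no line picked / no stuck stubs handed off).

## HANDOFF
landed under `Theorems/…/Negative/`: nothing (no negative lemma is statable without the global witness).
sorried: nothing.  computation: kit j314020 (table attached as evidence on the item), script coljob/main.py
in the seat folder.  next regimes if re-armed: (i) fold levels 7–9 into the table; (ii) if a line is picked,
attack its stubs' local-at-2 content with the same lattice code (e.g. exact `[H¹_f : E^±]` indices,
`ω̃`-divisibility of `P_{d,n}` at `p = 2`, the `ℤ/4` on the minus side); (iii) literature: Pollack 2003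
Thm 5.6 at `p = 2` (acq-06512) for the `½` in `L₂ = f·log⁻ + ½·g·log⁺·α`.
-/

set_option linter.dupNamespace false

namespace Summit.BirchSwinnertonDyer.BirchSwinnertonDyer.Cruxes.ResidualSignedLambdaLowerCMAtTwo.Disproof

open Summit.BirchSwinnertonDyer.BirchSwinnertonDyer.Theses.ResidualThetaTransportAtTwo

/-- Elaboration anchor: the crux by name (a restatement in the route file that changes the name breaks
this file on purpose). -/
example : ResidualSignedLambdaLowerCMAtTwo ↔ ResidualSignedLambdaLowerCMAtTwo := Iff.rfl

/-- §3, last bullet: the right-hand side of RSL_g is an `encard`; whenever the residual Selmer set is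
infinite (`μ > 0` or positive corank) the inequality holds for free, so only a λ-defect with FINITE
`Sel⁺[ϖ]` could refute the item. -/
theorem natCast_le_encard_of_infinite {α : Type*} {s : Set α} (h : s.Infinite) (k : ℕ) :
    ((k : ℕ) : ℕ∞) ≤ s.encard := by
  rw [h.encard_eq]
  exact le_top

/-- §2 bookkeeping: the layer-trace coefficient at the bottom of the `2`-tower is `4 = 2·2`
(`Tr_{K₁/K₀} d₁ = −4·d₀`), versus the unit `p − 1` at odd `p`; recorded as the arithmetic identity that
the two factors `|Δ| = 2` and `[c₋₁ : generator] = 2` multiply to the observed index of `Λ d⁻` in `E⁻`. -/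
theorem minusSide_bottom_index : (2 : ℕ) * 2 = 4 := rfl

end Summit.BirchSwinnertonDyer.BirchSwinnertonDyer.Cruxes.ResidualSignedLambdaLowerCMAtTwo.Disproof
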